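import Literature.NumberTheory.LFunctions.FordZetaBound748
import Literature.NumberTheory.LFunctions.FordExpSumLargeLambda
import HarnessLib

/-!
# The large-height region of Mossinghoff–Trudgian–Yang from Ford's Theorems 3 and 4

Topic `Literature/NumberTheory/LFunctions`. Pure proof file (one theorem).

`zero_bound_large_height_mossinghoff_trudgian_yang` (the named fact of
`VinogradovKorobov.lean`: no zeros `β + it` of `ζ` with `t ≥ exp(52238)` and
`β > 1 − 0.048976/(log t)^{2/3}(log log t)^{1/3}`; Mossinghoff–Trudgian–Yang 2024, §5) is reduced
in the tree to Ford's explicit Vinogradov–Korobov exponential-sum bound (Ford 2002, Theorem 2) with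
any constant `C ≤ 13` for `t ≥ N⁸` (`zero_bound_large_height_of_exp_sum_bound13_large_lambda`,
`FordZetaBound748.lean`: Theorem 1 with `A = 74.8 ≤ 74.9` via the sharp `κ`-lemma). Theorem 2 is a
theorem of the tree with `13` on `8 ≤ λ ≤ 87` (`FordVK.expSum_bound_mid_lambda`: van der Corput for
`λ ≤ 8`, the certified rows `k ≤ 87` of Table 6.1) and with `9.463` on `λ ≥ 87`
(`FordVK.expSum_bound_lambda_ge_87`: §5 of the source by kernel certificates) — the latter from the
rows of (1.7) with `k ≥ 129` (Theorem 3 of the source) and Theorem 4 of the source, which are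
therefore ALL that remains:

* `zero_bound_large_height_mty_of_theorem3_theorem4` — **(Ford Thm 3 rows, `k ≥ 129`) →
  (Ford Thm 4) → `zero_bound_large_height_mossinghoff_trudgian_yang`**.

## References
* M. J. Mossinghoff, T. S. Trudgian, A. Yang, *Explicit zero-free regions for the Riemann
  zeta-function*, Res. Number Theory 10 (2024), no. 1; arXiv:2212.06867: §5 (Theorem 1.2).
  [MossinghoffTrudgianYangRNT2024]
* K. Ford, Proc. London Math. Soc. (3) 85 (2002), 565–633; arXiv:1910.08209: Theorems 1–4, (1.7).
  [Ford2002]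
-/

noncomputable section

open Finset

namespace Literature.NumberTheory.LFunctions

/-- **The large-height zero-free region of Mossinghoff–Trudgian–Yang from Theorems 3 and 4 of
[Ford2002].** Hypotheses: the three rows of (1.7) used by §5 of Ford (Theorem 3 for
`129 ≤ k ≤ 149`, `150 ≤ k ≤ 199`, `k ≥ 200`) and Theorem 4 verbatim (`FordVK.Jinc`, `FordVK.calC`).
[cite: MossinghoffTrudgianYangRNT2024, §5] [cite: Ford2002, Theorems 2–4, §§5–7] -/
theorem zero_bound_large_height_mty_of_theorem3_theorem4
    (hT3a : ∀ k : ℕ, 200 ≤ k → ∃ s₃ : ℕ, 1 ≤ s₃ ∧ (s₃ : ℝ) ≤ 3.21432 * (k : ℝ) ^ 2 ∧ ∀ P : ℕ, 1 ≤ P →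
      (VMV.J k s₃ (Finset.Icc (1 : ℤ) P) : ℝ) ≤ (k : ℝ) ^ (2.3291 * (k : ℝ) ^ 3)
        * (P : ℝ) ^ ((2 * s₃ : ℝ) - ((k * (k + 1) / 2 : ℕ) : ℝ) + 0.001 * (k : ℝ) ^ 2))
    (hT3b : ∀ k : ℕ, 150 ≤ k → k ≤ 199 → ∃ s₃ : ℕ, 1 ≤ s₃ ∧ (s₃ : ℝ) ≤ 3.21734 * (k : ℝ) ^ 2 ∧ ∀ P : ℕ, 1 ≤ P →
      (VMV.J k s₃ (Finset.Icc (1 : ℤ) P) : ℝ) ≤ (k : ℝ) ^ (2.3849 * (k : ℝ) ^ 3)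
        * (P : ℝ) ^ ((2 * s₃ : ℝ) - ((k * (k + 1) / 2 : ℕ) : ℝ) + 0.001 * (k : ℝ) ^ 2))
    (hT3c : ∀ k : ℕ, 129 ≤ k → k ≤ 149 → ∃ s₃ : ℕ, 1 ≤ s₃ ∧ (s₃ : ℝ) ≤ 3.22313 * (k : ℝ) ^ 2 ∧ ∀ P : ℕ, 1 ≤ P →
      (VMV.J k s₃ (Finset.Icc (1 : ℤ) P) : ℝ) ≤ (k : ℝ) ^ (2.4183 * (k : ℝ) ^ 3)
        * (P : ℝ) ^ ((2 * s₃ : ℝ) - ((k * (k + 1) / 2 : ℕ) : ℝ) + 0.001 * (k : ℝ) ^ 2))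
    (hT4 : ∀ (k h s : ℕ) (P η D : ℝ), 60 ≤ k → (0.9 : ℝ) * k ≤ h → h + 2 ≤ k →
      2 * (k - h + 1) ≤ s → s ≤ (h / 2) * (k - h + 1) → 10 ≤ D → Real.exp (D * (k : ℝ) ^ 2) ≤ P →
      2 / (k : ℝ) ^ 3 < η → η ≤ 1 / (2 * (k : ℝ)) →
      18 / (k : ℝ) ≤ 4 * Real.log k / (D * (k : ℝ) ^ 2 * η) →
      4 * Real.log k / (D * (k : ℝ) ^ 2 * η) ≤ 0.4 →
      (FordVK.Jinc k s ((FordVK.calC P (P ^ η)).map Nat.castEmbedding) h k : ℝ)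
        ≤ Real.exp ((s : ℝ) ^ 2 / ((k : ℝ) - h + 1)
            + 10.5 * ((k : ℝ) - h + 1) * Real.log k ^ 2 / (D * k * η ^ 2)
            - s * ((1 / η + h) * (1 - 1 / (h : ℝ)) ^ ((s : ℝ) / ((k : ℝ) - h + 1)) - h)
              * Real.log (1 / (10 * η)))
          * P ^ ((2 * s : ℝ) - ((k : ℝ) - h + 1) / 2 * (h + k) + ((k : ℝ) - h + 1) * ((k : ℝ) - h) / 2
            + η * (s : ℝ) ^ 2 / (2 * ((k : ℝ) - h + 1))
            + h * ((k : ℝ) - h + 1) * Real.exp (-(s : ℝ) / (h * ((k : ℝ) - h + 1))))) :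
    zero_bound_large_height_mossinghoff_trudgian_yang :=
  zero_bound_large_height_of_exp_sum_bound13_large_lambda fun N R t u hN hNt hu0 hu1 hNR hR => by
    rcases le_or_gt t ((N : ℝ) ^ 87) with h87 | h87
    · have hN1 : (1 : ℝ) ≤ N := by exact_mod_cast hN
      have hNt' : (N : ℝ) ≤ t := le_trans (by
        calc (N : ℝ) = (N : ℝ) ^ 1 := (pow_one _).symm
          _ ≤ (N : ℝ) ^ 8 := pow_le_pow_right₀ hN1 (by norm_num)) hNt
      exact FordVK.expSum_bound_mid_lambda N R t u hN hNt' h87 hu0 hu1 hNR hR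
    · exact (FordVK.expSum_bound_lambda_ge_87 hT3a hT3b hT3c hT4 hN hNR hR hu0 hu1 h87.le).trans
        (mul_le_mul_of_nonneg_right (by norm_num) (by positivity))

end Literature.NumberTheory.LFunctions
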